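import Summits.KontsevichZagierPeriods.KontsevichZagierPeriods.Theorems.HyperbolicBlochFiveTermTransfer
import Summits.KontsevichZagierPeriods.KontsevichZagierPeriods.Theorems.HyperbolicBlochSectorReduction

/-!
# `TetraSector` (stmt-KontsevichZagierPeriods-3468) — the weight-2 scissors sector, target of route `HyperbolicBloch`

Zagier's conjecture in volume/ℤ-form (the inline hypothesis: every `ℤ`-linear relation among the
hyperbolic volumes `∫_{T(zᵢ)} t⁻³` of the standard ideal tetrahedra `T(zᵢ)`, `zᵢ ∈ ℚ̄ ∩ ℍ⁺`, lies
in the `ℤ`-span of the five-term instances over `ℚ̄`, the relators `[w] + [w̄]` and `[w]` for real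
`w`) implies the kernel form of Kontsevich–Zagier's Conjecture 1 on the subgroup of `KZ.FormalRep`
generated by the representations `[T(z), t⁻³]`: `Σ nᵢ value (ρ zᵢ) = 0 ⇒ Σ nᵢ [ρ zᵢ] ∈ KZ.relations`.

Proof: the tree's `SectorReduction.sectorReduction_proof : FiveTermTransfer → TetraSector`
(stmt-KontsevichZagierPeriods-3472; free-abelian-group bookkeeping: lift the signed class map to
`FreeAbelianGroup ℂ →+ KZ.FormalRep`, check the three relator families) applied to the five-term
transfer theorem `FiveTerm.FiveTermTransfer_of : FiveTermTransfer` (stmt-KontsevichZagierPeriods-3469: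
every five-term instance over `ℚ̄` is a relation of the KZ calculus in `ℍ³`). The statement is
unconditional; the transcendence content of the route stays in the explicit hypothesis of
`TetraSector` (the route item `ZagierDilogarithmConjecture`, an open conjecture, enters only the
deciding theorem `closes`). [cite: DupontSah1982, §5] [cite: Neumann1998, §2.1]
-/

namespace Summit.KontsevichZagierPeriods.HyperbolicBloch.TetraSector

open Summit.KontsevichZagierPeriods.KontsevichZagierPeriods.Theses.HyperbolicBloch (TetraSector)
open Summit.KontsevichZagierPeriods.HyperbolicBloch.SectorReduction (sectorReduction_proof)
open Summit.KontsevichZagierPeriods.HyperbolicBloch.FiveTerm (FiveTermTransfer_of)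

/-- **`TetraSector`** (stmt-KontsevichZagierPeriods-3468, target of route `HyperbolicBloch`): the
kernel form of Conjecture 1 on the tetrahedral subgroup, conditional only on its inline hypothesis
(Zagier's dilogarithm conjecture in volume/ℤ-form). Composition of `sectorReduction_proof`
(`FiveTermTransfer → TetraSector`) with `FiveTermTransfer_of`. [folklore] -/
theorem tetraSector_proof : TetraSector :=
  sectorReduction_proof FiveTermTransfer_of

end Summit.KontsevichZagierPeriods.HyperbolicBloch.TetraSector
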